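import Summits.RiemannHypothesis.RiemannHypothesis.Theorems.PfPersistenceEigenvectorTolerance
import HarnessLib

/-!
# PF persistence — CONE CONTINUITY: ordinary continuity + scale-freeness of an eigenvector reader give the cone
# hypothesis of the eigenvector-tolerance walls
(pub-rhpf, barrier-prover gen 3; completes the G1.22ev closure of `PfPersistenceEigenvectorTolerance`)

**HONEST FRAMING. This is a long-odds MECHANISM SEARCH; no RH claims.** RH-free; every statement PROVED; the only
non-theorem inputs are the explicit per-window gap binders `HasBottomGap (zetaDatum win) u₀ γ` of the companion
file and, per reader, ORDINARY HYPOTHESES ON THE READER (continuity at `ζ`'s bottom vector(s), invariance under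
rescaling of each eigenvector, and a STRICT margin of `ζ`'s reading off the threshold) — hypotheses, never asserted.

The walls of `PfPersistenceEigenvectorTolerance` close a bottom-vector SHAPE reader `P` modulo the CONE HYPOTHESIS
"`P` holds on a punctured `τ`-cone of `u₀`". This file discharges that hypothesis for the readers the cell
actually serves — real-valued functions `Φ` of the (tuple of) bottom eigenvector(s), thresholded:
* §1 RESCALING INTO A BALL (`rescale_sub_dotSelf_le`): if `u ≠ 0` lies in the `τ`-cone of `u₀` then the rescaled
  vector `v := ((u·u₀)/|u|²) u` satisfies `|v − u₀|² ≤ τ|u₀|²` — no square roots, no normalisation.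
* §2 CONE CONTINUITY (`ConeContinuousAt Φ u₀`: `∀ η > 0, ∃ τ > 0`, `|Φ u − Φ u₀| < η` on the punctured `τ`-cone)
  follows from `ContinuousAt Φ u₀` + scale-invariance `Φ (t • u) = Φ u` (`t ≠ 0`) + `u₀ ≠ 0`
  (`coneContinuousAt_of_continuousAt`); the TUPLE version for joint readers of the bottom vectors at `k` windows
  (`coneContinuousAt_tuple_of_continuousAt`).
* §3 THE WALLS FOR THRESHOLDED CONTINUOUS SCALE-FREE EIGENVECTOR READERS at finitely many gapped windows, with
  `ζ`'s reading STRICTLY off the threshold (`not_separates_of_reader_gt_subset`, `…_tuple_…`), and for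
  EIGENVECTOR MARGIN READERS (`|Φ u − Φ u₀| < η`, `not_separates_of_reader_margin_subset`, `…_tuple_…`): such a
  class, restricted to the arithmetic dial space, separates `ζ` from the negatives of no `D ⊇ arithDialSpace`.
HONEST RESIDUE (= gap class G1, recorded not targeted): readers AT threshold on `ζ` (no margin), discontinuous
readers (nodal COUNTS jump — but they are covered by the cone lemma whenever the count is locally constant on a
cone), and `∀`-window / sliding-window readers.
-/

set_option linter.dupNamespace false  -- the mandated namespace repeats `RiemannHypothesis`

noncomputable section

open Real Finset Matrix Set

namespace Summit.RiemannHypothesis.RiemannHypothesis.Theorems.PfPersistence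

/-! ## §1 Rescaling a cone vector into a Euclidean ball around the reference -/

/-- PROVED: in a `τ`-cone with `τ < 1` around a nonzero `u₀`, a nonzero vector is not orthogonal to `u₀`. [folklore] -/
theorem dotProduct_ne_zero_of_sinSqLe {n : ℕ} {τ : ℝ} {u u₀ : Fin n → ℝ} (h : SinSqLe τ u u₀) (hτ : τ < 1)
    (hu : u ≠ 0) (hu₀ : u₀ ≠ 0) : u ⬝ᵥ u₀ ≠ 0 := by
  intro h0
  have hs : 0 < u ⬝ᵥ u := dotSelf_pos_of_ne_zero hu
  have hs₀ : 0 < u₀ ⬝ᵥ u₀ := dotSelf_pos_of_ne_zero hu₀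
  have h' : (1 - τ) * ((u ⬝ᵥ u) * (u₀ ⬝ᵥ u₀)) ≤ (u ⬝ᵥ u₀) ^ 2 := h
  rw [h0] at h'
  nlinarith [mul_pos hs hs₀]

/-- **PROVED — RESCALING INTO A BALL.** If `u ≠ 0` lies in the `τ`-cone of `u₀` (`SinSqLe τ u u₀`), the rescaled
vector `v := ((u·u₀)/|u|²) • u` satisfies `|v − u₀|² ≤ τ |u₀|²`. [folklore] -/
theorem rescale_sub_dotSelf_le {n : ℕ} {τ : ℝ} {u u₀ : Fin n → ℝ} (h : SinSqLe τ u u₀) (hu : u ≠ 0) :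
    (((u ⬝ᵥ u₀) / (u ⬝ᵥ u)) • u - u₀) ⬝ᵥ (((u ⬝ᵥ u₀) / (u ⬝ᵥ u)) • u - u₀) ≤ τ * (u₀ ⬝ᵥ u₀) := by
  have hs : 0 < u ⬝ᵥ u := dotSelf_pos_of_ne_zero hu
  have h' : (1 - τ) * ((u ⬝ᵥ u) * (u₀ ⬝ᵥ u₀)) ≤ (u ⬝ᵥ u₀) ^ 2 := h
  have hexp : (((u ⬝ᵥ u₀) / (u ⬝ᵥ u)) • u - u₀) ⬝ᵥ (((u ⬝ᵥ u₀) / (u ⬝ᵥ u)) • u - u₀) =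
      u₀ ⬝ᵥ u₀ - (u ⬝ᵥ u₀) ^ 2 / (u ⬝ᵥ u) := by
    simp only [sub_dotProduct, dotProduct_sub, smul_dotProduct, dotProduct_smul, smul_eq_mul, dotProduct_comm u₀ u]
    field_simp
    ring
  rw [hexp]
  have hdiv : (1 - τ) * (u₀ ⬝ᵥ u₀) ≤ (u ⬝ᵥ u₀) ^ 2 / (u ⬝ᵥ u) := by
    rw [le_div_iff₀ hs]
    nlinarith [h']
  nlinarith [hdiv]

/-- PROVED: a real vector whose squared Euclidean length is `< δ²` has (sup-)norm `< δ`. [folklore] -/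
theorem norm_lt_of_dotSelf_lt_sq {n : ℕ} {x : Fin n → ℝ} {δ : ℝ} (hδ : 0 < δ) (h : x ⬝ᵥ x < δ ^ 2) : ‖x‖ < δ := by
  rw [pi_norm_lt_iff hδ]
  intro i
  rw [Real.norm_eq_abs]
  refine abs_lt_of_sq_lt_sq (lt_of_le_of_lt ?_ h) hδ.le
  exact coord_sq_le_dotSelf x i

/-! ## §2 Cone continuity from ordinary continuity and scale-freeness -/

/-- CONE CONTINUITY of a real reader of one coefficient vector at `u₀`: for every `η > 0` some punctured `τ`-cone
of `u₀` is mapped into `(Φ u₀ − η, Φ u₀ + η)`. This is exactly the cone hypothesis the tolerance walls consume. -/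
def ConeContinuousAt {n : ℕ} (Φ : (Fin n → ℝ) → ℝ) (u₀ : Fin n → ℝ) : Prop :=
  ∀ η : ℝ, 0 < η → ∃ τ : ℝ, 0 < τ ∧ ∀ u : Fin n → ℝ, u ≠ 0 → SinSqLe τ u u₀ → |Φ u - Φ u₀| < η

/-- **PROVED — CONE CONTINUITY FROM ORDINARY CONTINUITY + SCALE-FREENESS.** A reader `Φ` continuous at `u₀ ≠ 0`
(any product norm) and invariant under nonzero rescaling of its argument is cone-continuous at `u₀`
(`τ := min (1/2) (δ²/(2|u₀|²))`; rescale the cone vector into the `δ`-ball by `rescale_sub_dotSelf_le`). [folklore] -/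
theorem coneContinuousAt_of_continuousAt {n : ℕ} {Φ : (Fin n → ℝ) → ℝ} {u₀ : Fin n → ℝ}
    (hΦ : ContinuousAt Φ u₀) (hscale : ∀ t : ℝ, t ≠ 0 → ∀ u : Fin n → ℝ, Φ (t • u) = Φ u) (hu₀ : u₀ ≠ 0) :
    ConeContinuousAt Φ u₀ := by
  intro η hη
  obtain ⟨δ, hδ, hball⟩ := Metric.continuousAt_iff.1 hΦ η hη
  have hs₀ : 0 < u₀ ⬝ᵥ u₀ := dotSelf_pos_of_ne_zero hu₀
  refine ⟨min (1 / 2) (δ ^ 2 / (2 * (u₀ ⬝ᵥ u₀))), lt_min (by norm_num) (by positivity), fun u hu hcone => ?_⟩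
  set τ := min (1 / 2) (δ ^ 2 / (2 * (u₀ ⬝ᵥ u₀))) with hτ_def
  have hτ1 : τ < 1 := lt_of_le_of_lt (min_le_left _ _) (by norm_num)
  have hτδ : τ * (u₀ ⬝ᵥ u₀) < δ ^ 2 := by
    have h1 : τ * (u₀ ⬝ᵥ u₀) ≤ δ ^ 2 / (2 * (u₀ ⬝ᵥ u₀)) * (u₀ ⬝ᵥ u₀) :=
      mul_le_mul_of_nonneg_right (min_le_right _ _) hs₀.le
    have h2 : δ ^ 2 / (2 * (u₀ ⬝ᵥ u₀)) * (u₀ ⬝ᵥ u₀) = δ ^ 2 / 2 := by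
      field_simp
    have h3 : 0 < δ ^ 2 := by positivity
    linarith
  have hs : 0 < u ⬝ᵥ u := dotSelf_pos_of_ne_zero hu
  have ht : (u ⬝ᵥ u₀) / (u ⬝ᵥ u) ≠ 0 :=
    div_ne_zero (dotProduct_ne_zero_of_sinSqLe hcone hτ1 hu hu₀) hs.ne'
  set v := ((u ⬝ᵥ u₀) / (u ⬝ᵥ u)) • u with hv_def
  have hvball : dist v u₀ < δ := by
    rw [dist_eq_norm]
    exact norm_lt_of_dotSelf_lt_sq hδ (lt_of_le_of_lt (rescale_sub_dotSelf_le hcone hu) hτδ)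
  have hΦv : Φ v = Φ u := hscale _ ht u
  have := hball hvball
  rwa [Real.dist_eq, hΦv] at this

/-- PROVED: a cone-continuous reader STRICTLY above a threshold at `u₀` stays above it on a punctured cone — the cone
hypothesis of `not_separates_of_bottomVectorReaderAt_subset` for the shape `θ < Φ u`. [folklore] -/
theorem exists_cone_of_gt {n : ℕ} {Φ : (Fin n → ℝ) → ℝ} {u₀ : Fin n → ℝ} (hΦ : ConeContinuousAt Φ u₀) {θ : ℝ}
    (hθ : θ < Φ u₀) : ∃ τ : ℝ, 0 < τ ∧ ∀ u : Fin n → ℝ, u ≠ 0 → SinSqLe τ u u₀ → θ < Φ u := by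
  obtain ⟨τ, hτ, h⟩ := hΦ (Φ u₀ - θ) (by linarith)
  exact ⟨τ, hτ, fun u hu hc => by have := (abs_lt.1 (h u hu hc)).1; linarith⟩

/-- PROVED: the same below a threshold. [folklore] -/
theorem exists_cone_of_lt {n : ℕ} {Φ : (Fin n → ℝ) → ℝ} {u₀ : Fin n → ℝ} (hΦ : ConeContinuousAt Φ u₀) {θ : ℝ}
    (hθ : Φ u₀ < θ) : ∃ τ : ℝ, 0 < τ ∧ ∀ u : Fin n → ℝ, u ≠ 0 → SinSqLe τ u u₀ → Φ u < θ := by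
  obtain ⟨τ, hτ, h⟩ := hΦ (θ - Φ u₀) (by linarith)
  exact ⟨τ, hτ, fun u hu hc => by have := (abs_lt.1 (h u hu hc)).2; linarith⟩

/-- CONE CONTINUITY of a real reader of a TUPLE of coefficient vectors (joint readers of the bottom vectors at `k`
windows: transport rates, relative directions, …) at the reference tuple `U₀`. -/
def ConeContinuousAtTuple {k : ℕ} {W : Fin k → Window} (Φ : ((i : Fin k) → (Fin ((W i).N + 1) → ℝ)) → ℝ)
    (U₀ : (i : Fin k) → (Fin ((W i).N + 1) → ℝ)) : Prop :=
  ∀ η : ℝ, 0 < η → ∃ τ : ℝ, 0 < τ ∧ ∀ u : (i : Fin k) → (Fin ((W i).N + 1) → ℝ),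
    (∀ i, u i ≠ 0) → (∀ i, SinSqLe τ (u i) (U₀ i)) → |Φ u - Φ U₀| < η

/-- **PROVED — TUPLE CONE CONTINUITY FROM ORDINARY CONTINUITY + COMPONENTWISE SCALE-FREENESS.** [folklore] -/
theorem coneContinuousAtTuple_of_continuousAt {k : ℕ} {W : Fin k → Window}
    {Φ : ((i : Fin k) → (Fin ((W i).N + 1) → ℝ)) → ℝ} {U₀ : (i : Fin k) → (Fin ((W i).N + 1) → ℝ)}
    (hΦ : ContinuousAt Φ U₀)
    (hscale : ∀ t : Fin k → ℝ, (∀ i, t i ≠ 0) →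
      ∀ u : (i : Fin k) → (Fin ((W i).N + 1) → ℝ), Φ (fun i => t i • u i) = Φ u)
    (hU₀ : ∀ i, U₀ i ≠ 0) : ConeContinuousAtTuple Φ U₀ := by
  intro η hη
  obtain ⟨δ, hδ, hball⟩ := Metric.continuousAt_iff.1 hΦ η hη
  -- a uniform cone parameter: `τ |U₀ i|² < δ²` for every `i`, and `τ < 1`
  set A : ℝ := 1 + ∑ i, U₀ i ⬝ᵥ U₀ i with hA_def
  have hA : 0 < A := by
    have : 0 ≤ ∑ i, U₀ i ⬝ᵥ U₀ i := Finset.sum_nonneg fun i _ => dotProduct_self_nonneg_real (U₀ i)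
    linarith
  have hAi : ∀ i, U₀ i ⬝ᵥ U₀ i ≤ A := fun i => by
    have := Finset.single_le_sum (fun j (_ : j ∈ Finset.univ) => dotProduct_self_nonneg_real (U₀ j))
      (Finset.mem_univ i)
    linarith
  refine ⟨min (1 / 2) (δ ^ 2 / (2 * A)), lt_min (by norm_num) (by positivity), fun u hu hcone => ?_⟩
  set τ := min (1 / 2) (δ ^ 2 / (2 * A)) with hτ_def
  have hτ0 : 0 < τ := lt_min (by norm_num) (by positivity)
  have hτ1 : τ < 1 := lt_of_le_of_lt (min_le_left _ _) (by norm_num)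
  have hτδ : ∀ i, τ * (U₀ i ⬝ᵥ U₀ i) < δ ^ 2 := fun i => by
    have h1 : τ * (U₀ i ⬝ᵥ U₀ i) ≤ δ ^ 2 / (2 * A) * A :=
      mul_le_mul (min_le_right _ _) (hAi i) (dotProduct_self_nonneg_real _) (by positivity)
    have h2 : δ ^ 2 / (2 * A) * A = δ ^ 2 / 2 := by
      field_simp
    have h3 : 0 < δ ^ 2 := by positivity
    linarith
  set t : Fin k → ℝ := fun i => (u i ⬝ᵥ U₀ i) / (u i ⬝ᵥ u i) with ht_def
  have ht : ∀ i, t i ≠ 0 := fun i =>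
    div_ne_zero (dotProduct_ne_zero_of_sinSqLe (hcone i) hτ1 (hu i) (hU₀ i)) (dotSelf_pos_of_ne_zero (hu i)).ne'
  set v : (i : Fin k) → (Fin ((W i).N + 1) → ℝ) := fun i => t i • u i with hv_def
  have hvball : dist v U₀ < δ := by
    rw [dist_eq_norm, pi_norm_lt_iff hδ]
    intro i
    have : (v - U₀) i = t i • u i - U₀ i := rfl
    rw [this]
    exact norm_lt_of_dotSelf_lt_sq hδ (lt_of_le_of_lt (rescale_sub_dotSelf_le (hcone i) (hu i)) (hτδ i))
  have hΦv : Φ v = Φ u := hscale t ht u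
  have := hball hvball
  rwa [Real.dist_eq, hΦv] at this

/-- PROVED: a cone-continuous tuple reader strictly above a threshold at `U₀` stays above it on a product of
punctured cones. [folklore] -/
theorem exists_cone_tuple_of_gt {k : ℕ} {W : Fin k → Window}
    {Φ : ((i : Fin k) → (Fin ((W i).N + 1) → ℝ)) → ℝ} {U₀ : (i : Fin k) → (Fin ((W i).N + 1) → ℝ)}
    (hΦ : ConeContinuousAtTuple Φ U₀) {θ : ℝ} (hθ : θ < Φ U₀) :
    ∃ τ : ℝ, 0 < τ ∧ ∀ u : (i : Fin k) → (Fin ((W i).N + 1) → ℝ),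
      (∀ i, u i ≠ 0) → (∀ i, SinSqLe τ (u i) (U₀ i)) → θ < Φ u := by
  obtain ⟨τ, hτ, h⟩ := hΦ (Φ U₀ - θ) (by linarith)
  exact ⟨τ, hτ, fun u hu hc => by have := (abs_lt.1 (h u hu hc)).1; linarith⟩

/-! ## §3 The walls for thresholded continuous scale-free eigenvector readers -/

/-- **PROVED — THE WALL FOR A THRESHOLDED CONTINUOUS SCALE-FREE READER OF THE BOTTOM VECTOR AT ONE GAPPED WINDOW,
`ζ`'s reading strictly above the threshold** (universal form `∀ u bottom, θ < Φ u`; modulo the gap binder,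
otherwise UNCONDITIONAL). [folklore] -/
theorem not_separates_of_reader_gt_subset (win : Window) {u₀ : Fin (win.N + 1) → ℝ} {γ : ℝ}
    (hgap : HasBottomGap (zetaDatum win) u₀ γ) {Φ : (Fin (win.N + 1) → ℝ) → ℝ} (hΦ : ContinuousAt Φ u₀)
    (hscale : ∀ t : ℝ, t ≠ 0 → ∀ u : Fin (win.N + 1) → ℝ, Φ (t • u) = Φ u) {θ : ℝ} (hθ : θ < Φ u₀)
    {S D : Set Datum} (hS : {d | ∀ u, IsBottomVector (d win) u → θ < Φ u} ∩ arithDialSpace ⊆ S)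
    (hD : arithDialSpace ⊆ D) : ¬ Separates S D zetaDatum := by
  obtain ⟨τ, hτ, hcone⟩ := exists_cone_of_gt (coneContinuousAt_of_continuousAt hΦ hscale hgap.1.1) hθ
  exact not_separates_of_robustWithin_arith hD
    (((robustWithin_dialSpace_forall_bottomVectorReaderAt win hgap hτ hcone).anti
      arithDialSpace_subset_dialSpace).mono hS)

/-- **PROVED — the existential form** (`∃ u bottom, θ < Φ u`). [folklore] -/
theorem not_separates_of_exists_reader_gt_subset (win : Window) {u₀ : Fin (win.N + 1) → ℝ} {γ : ℝ}
    (hgap : HasBottomGap (zetaDatum win) u₀ γ) {Φ : (Fin (win.N + 1) → ℝ) → ℝ} (hΦ : ContinuousAt Φ u₀)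
    (hscale : ∀ t : ℝ, t ≠ 0 → ∀ u : Fin (win.N + 1) → ℝ, Φ (t • u) = Φ u) {θ : ℝ} (hθ : θ < Φ u₀)
    {S D : Set Datum} (hS : {d | ∃ u, IsBottomVector (d win) u ∧ θ < Φ u} ∩ arithDialSpace ⊆ S)
    (hD : arithDialSpace ⊆ D) : ¬ Separates S D zetaDatum := by
  obtain ⟨τ, hτ, hcone⟩ := exists_cone_of_gt (coneContinuousAt_of_continuousAt hΦ hscale hgap.1.1) hθ
  exact not_separates_of_bottomVectorReaderAt_subset win hgap hτ hcone hS hD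

/-- **PROVED — THE WALL FOR A THRESHOLDED CONTINUOUS, COMPONENTWISE SCALE-FREE JOINT READER OF THE BOTTOM VECTORS
AT FINITELY MANY GAPPED WINDOWS (`L_k × R0` transport / direction readers), `ζ`'s reading strictly above the
threshold** (universal form; modulo the gap binders, otherwise UNCONDITIONAL). Readings strictly BELOW a threshold:
apply this to `−Φ`. [folklore] -/
theorem not_separates_of_tuple_reader_gt_subset {k : ℕ} {W : Fin k → Window}
    {U₀ : (i : Fin k) → (Fin ((W i).N + 1) → ℝ)} {γ : Fin k → ℝ}
    (hgap : ∀ i, HasBottomGap (zetaDatum (W i)) (U₀ i) (γ i))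
    {Φ : ((i : Fin k) → (Fin ((W i).N + 1) → ℝ)) → ℝ} (hΦ : ContinuousAt Φ U₀)
    (hscale : ∀ t : Fin k → ℝ, (∀ i, t i ≠ 0) →
      ∀ u : (i : Fin k) → (Fin ((W i).N + 1) → ℝ), Φ (fun i => t i • u i) = Φ u)
    {θ : ℝ} (hθ : θ < Φ U₀) {S D : Set Datum}
    (hS : {d | ∀ u : (i : Fin k) → (Fin ((W i).N + 1) → ℝ), (∀ i, IsBottomVector (d (W i)) (u i)) → θ < Φ u} ∩
      arithDialSpace ⊆ S) (hD : arithDialSpace ⊆ D) : ¬ Separates S D zetaDatum := by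
  obtain ⟨τ, hτ, hcone⟩ :=
    exists_cone_tuple_of_gt (coneContinuousAtTuple_of_continuousAt hΦ hscale fun i => (hgap i).1.1) hθ
  exact not_separates_of_forall_tuple_subset hgap hτ hcone hS hD

/-- **PROVED — THE WALL FOR AN EIGENVECTOR MARGIN READER** ("`Φ` of every bottom vector at `win` is within `η` of
`ζ`'s reading `Φ u₀`", `η > 0`), `Φ` continuous at `u₀` and scale-free; modulo the gap binder, otherwise
UNCONDITIONAL. [folklore] -/
theorem not_separates_of_reader_margin_subset (win : Window) {u₀ : Fin (win.N + 1) → ℝ} {γ : ℝ}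
    (hgap : HasBottomGap (zetaDatum win) u₀ γ) {Φ : (Fin (win.N + 1) → ℝ) → ℝ} (hΦ : ContinuousAt Φ u₀)
    (hscale : ∀ t : ℝ, t ≠ 0 → ∀ u : Fin (win.N + 1) → ℝ, Φ (t • u) = Φ u) {η : ℝ} (hη : 0 < η)
    {S D : Set Datum} (hS : {d | ∀ u, IsBottomVector (d win) u → |Φ u - Φ u₀| < η} ∩ arithDialSpace ⊆ S)
    (hD : arithDialSpace ⊆ D) : ¬ Separates S D zetaDatum := by
  obtain ⟨τ, hτ, hcone⟩ := coneContinuousAt_of_continuousAt hΦ hscale hgap.1.1 η hη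
  exact not_separates_of_robustWithin_arith hD
    (((robustWithin_dialSpace_forall_bottomVectorReaderAt win hgap hτ hcone).anti
      arithDialSpace_subset_dialSpace).mono hS)

/-- **PROVED — THE WALL FOR A JOINT EIGENVECTOR MARGIN READER AT FINITELY MANY GAPPED WINDOWS** ("`Φ` of every
tuple of bottom vectors is within `η` of `ζ`'s reading `Φ U₀`"), `Φ` continuous at `U₀` and componentwise
scale-free; modulo the gap binders, otherwise UNCONDITIONAL. [folklore] -/
theorem not_separates_of_tuple_reader_margin_subset {k : ℕ} {W : Fin k → Window}
    {U₀ : (i : Fin k) → (Fin ((W i).N + 1) → ℝ)} {γ : Fin k → ℝ}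
    (hgap : ∀ i, HasBottomGap (zetaDatum (W i)) (U₀ i) (γ i))
    {Φ : ((i : Fin k) → (Fin ((W i).N + 1) → ℝ)) → ℝ} (hΦ : ContinuousAt Φ U₀)
    (hscale : ∀ t : Fin k → ℝ, (∀ i, t i ≠ 0) →
      ∀ u : (i : Fin k) → (Fin ((W i).N + 1) → ℝ), Φ (fun i => t i • u i) = Φ u)
    {η : ℝ} (hη : 0 < η) {S D : Set Datum}
    (hS : {d | ∀ u : (i : Fin k) → (Fin ((W i).N + 1) → ℝ), (∀ i, IsBottomVector (d (W i)) (u i)) →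
      |Φ u - Φ U₀| < η} ∩ arithDialSpace ⊆ S) (hD : arithDialSpace ⊆ D) : ¬ Separates S D zetaDatum := by
  obtain ⟨τ, hτ, hcone⟩ := coneContinuousAtTuple_of_continuousAt hΦ hscale (fun i => (hgap i).1.1) η hη
  exact not_separates_of_forall_tuple_subset hgap hτ hcone hS hD

end Summit.RiemannHypothesis.RiemannHypothesis.Theorems.PfPersistence

end
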